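/-
Copyright (c) 2026 the pub-hodgecm-mathlib formalisation cell (harness21).  Prover seat hodgecm-mathlib-K2Liu-p14 (g2), Track B «K2-LIT»,
#184♮ = hLiu418 = `stmt-HodgeConjecture-24832`; #42F′ Road I, A7-val ROAD (σ) «null-cone multiplicity one» (K2Liu-p09 (g6) memo
`REPORT-FIRST-A7val-PaperFirst.K2Liu-p09-g6.md` 0ec4b1215f8a4fcc §3), brick V3 (K2E5-plan (g7) fan-out 11:19:22Z; LEAD F0P6-plan (g14) «M-158d»).
-/
import Summits.HodgeConjecture.HodgeConjecture.Theorems.K2LiuHermitianWittTransitive   -- ★ Witt: `exists_forall_apply_eq`, `exists_isometry_map_eq`, `injective_of_isometry`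
import Mathlib.LinearAlgebra.FiniteDimensional.Lemmas
import Mathlib.LinearAlgebra.Dimension.Finrank
import Mathlib.LinearAlgebra.Matrix.NonsingularInverse
import Mathlib.Data.Matrix.Mul
import HarnessLib

/-!
# Crux `HLiu418`, A7-val road (σ), brick V3 (O1): THE PUNCTURED NULL CONE OF PAIRS IN A NON-DEGENERATE HERMITIAN 3-SPACE OVER A FIELD IS ONE ORBIT OF
# `GL₂ × U(V′)` — null pairs are `c ⊗ u` (`u` isotropic), and Witt + `GL₂`-transitivity move any one to any other

Cell `hodgecm-mathlib`, crux item hLiu418 = `stmt-HodgeConjecture-24832`; squad K2 ∕ K2Liu; prover K2Liu-p14 (g2).  THEOREMS ONLY (no `def`, no instance, no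
notation, no named-fact hypothesis, no `sorry`); lane `--supports stmt-HodgeConjecture-24832 --as helper`.

SETTING (abstract currency of ★ `K2LiuHermitianWittTransitive`): a field `L` with a ring endomorphism `c` (`c ∘ c = id`, `2 ≠ 0`), a finite-dimensional `L`-space `V`
with a `c`-sesquilinear form `B : V →ₛₗ[c] V →ₗ[L] L`, hermitian (`c (B x y) = B y x`) and non-degenerate (`(∀ y, B x y = 0) → x = 0`), of dimension `finrank L V = 3`
(the local hermitian space `V′_v = V′ ⊗ L⁺_v` at a NON-SPLIT place `v`, where `L ⊗ L⁺_v` is a field).  A NULL PAIR is `x : Fin 2 → V` with all `B (x i) (x j) = 0` — a point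
of the null cone `𝒩 = {Q = 0}` of the moment map `Q(x) = (B (x i) (x j))_{ij} ∈ Herm₂` on `X = V^{⊕2} = V ⊗ E²`.
* §1 `exists_matrix_two_mulVec_eq` — `GL₂(L)` is transitive on `L² ∖ 0` (explicit matrices).
* §2 **`not_linearIndependent_of_null_pair`** — a null pair is linearly DEPENDENT: if independent, `y ↦ (B (x i) y)_i` is onto `L²` (non-degeneracy, ★
  `exists_forall_apply_eq`) with both `x i` in its kernel, so `2 ≤ dim ker = 3 − 2 = 1` (rank–nullity) — no Witt-index hypothesis needed;
  **`exists_eq_smul_of_null_pair`** — hence `x = c ⊗ u`: `x i = c i • u` with `u ≠ 0` isotropic and `c ∈ L² ∖ 0`.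
* §3 **`exists_isometry_matrix_of_null_pairs`** — (O1) ONE ORBIT: for null pairs `x, x′ ≠ 0` there are an isometry `g` of `(V, B)` and `a ∈ GL₂(L)` with
  `Σ_j a_{ij} • g (x j) = x′ i` (★ Witt `exists_isometry_map_eq` on the isotropic LINES `⟨u⟩ ↦ ⟨u′⟩`, then §1 on the coefficient vectors).
* §4 the COORDINATE forms: `exists_unitary_matrix_of_null_pairs` (`V = L³`, Gram matrix `J`, `g ∈ unitaryGroupOfForm c J`, pairs `Fin 2 → L³`) and, in the MATRIX
  currency of the V5 consumer (K2Liu-p09 (g6) 11:27:21Z (q1)), **`exists_unitary_mul_mul_eq_of_null`**: `X : Matrix (Fin 3) (Fin 2) L`, `Q(X) = (X.map c)ᵀ J X = 0 ≠ X` ⇒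
  `∃ g ∈ U(J), ∃ a ∈ GL₂, g * X * a = X′`.  (The SPLIT orbit table (O2) is the sequel `K2LiuNullConeOrbitsSplit`.)
References: [Scharlau1985HermitianForms, Ch. 7 §9 (Witt)]; [KudlaRallis1990, §2 (orbits in the null cone)]; [Rallis1984]; [BernsteinZelevinsky1976, §1.5].
HONEST LABEL.  Count-neutral helper: `HC_CM` is proved only modulo the 7 printed citations (2 remaining named inputs: hLiu418 = `stmt-HodgeConjecture-24832`,
h413 = `stmt-HodgeConjecture-24833`) until rung 0 closes.
-/

set_option autoImplicit false
set_option linter.dupNamespace false -- the mandated namespace repeats `HodgeConjecture.HodgeConjecture`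

namespace Summit.HodgeConjecture.HodgeConjecture.Cruxes.HLiu418.K2LiuNullConeOrbits

open Module Matrix
open Summit.HodgeConjecture.HodgeConjecture.Cruxes.HLiu418.K2LiuHermitianWitt

/-! ## §1 `GL₂(L)` is transitive on `L² ∖ 0` -/

section GLTwo

variable {L : Type*} [Field L]

/-- an invertible `2 × 2` matrix with first column a given non-zero vector `p`. [folklore] -/
theorem exists_matrix_two_mulVec_single (p : Fin 2 → L) (hp : p ≠ 0) :
    ∃ N : Matrix (Fin 2) (Fin 2) L, IsUnit N.det ∧ N *ᵥ Pi.single 0 1 = p := by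
  by_cases h0 : p 0 = 0
  · have h1 : p 1 ≠ 0 := by
      intro h1
      apply hp
      funext i
      fin_cases i
      · exact h0
      · exact h1
    refine ⟨!![p 0, 1; p 1, 0], ?_, ?_⟩
    · rw [Matrix.det_fin_two_of, isUnit_iff_ne_zero]
      rw [h0, zero_mul, zero_sub, neg_ne_zero, one_mul]
      exact h1
    · funext i
      fin_cases i <;> simp [Matrix.mulVec, dotProduct, Fin.sum_univ_two]
  · refine ⟨!![p 0, 0; p 1, 1], ?_, ?_⟩
    · rw [Matrix.det_fin_two_of, isUnit_iff_ne_zero, mul_one, zero_mul, sub_zero]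
      exact h0
    · funext i
      fin_cases i <;> simp [Matrix.mulVec, dotProduct, Fin.sum_univ_two]

/-- **`GL₂(L)` IS TRANSITIVE ON `L² ∖ 0`**: for non-zero `p, q ∈ L²` there is an invertible `M` with `M p = q`. [folklore] -/
theorem exists_matrix_two_mulVec_eq (p q : Fin 2 → L) (hp : p ≠ 0) (hq : q ≠ 0) :
    ∃ M : Matrix (Fin 2) (Fin 2) L, IsUnit M.det ∧ M *ᵥ p = q := by
  obtain ⟨Np, hNp, hp'⟩ := exists_matrix_two_mulVec_single p hp
  obtain ⟨Nq, hNq, hq'⟩ := exists_matrix_two_mulVec_single q hq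
  refine ⟨Nq * Np⁻¹, ?_, ?_⟩
  · rw [Matrix.det_mul, Matrix.det_nonsing_inv]
    exact hNq.mul hNp.ringInverse
  · rw [← hp', Matrix.mulVec_mulVec, Matrix.mul_assoc, Matrix.nonsing_inv_mul _ hNp, Matrix.mul_one, hq']

end GLTwo

/-! ## §2 Null pairs are `c ⊗ u` -/

section NullPairs

variable {L V : Type*} [Field L] [AddCommGroup V] [Module L V] {c : L →+* L}

/-- a null pair lies in the kernel of its own moment map `y ↦ (B (x i) y)_i`. [cite: KudlaRallis1990, §2] -/
theorem mem_ker_pi_of_null_pair (B : V →ₛₗ[c] V →ₗ[L] L) {x : Fin 2 → V} (hx : ∀ i j, B (x i) (x j) = 0) (j : Fin 2) :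
    x j ∈ LinearMap.ker (LinearMap.pi fun i => B (x i)) := by
  rw [LinearMap.mem_ker]
  funext i
  rw [LinearMap.pi_apply, Pi.zero_apply]
  exact hx i j

/-- **A NULL PAIR IN A NON-DEGENERATE HERMITIAN 3-SPACE IS LINEARLY DEPENDENT** (`dim` of a totally isotropic subspace `≤ 1`: rank–nullity for the moment map, which
is onto `L²` on an independent pair by non-degeneracy). [cite: Scharlau1985HermitianForms, Ch. 7 §9] [cite: KudlaRallis1990, §2] -/
theorem not_linearIndependent_of_null_pair [FiniteDimensional L V] (B : V →ₛₗ[c] V →ₗ[L] L) (hc : ∀ x, c (c x) = x)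
    (hnd : ∀ x, (∀ y, B x y = 0) → x = 0) (hV : finrank L V = 3)
    {x : Fin 2 → V} (hx : ∀ i j, B (x i) (x j) = 0) : ¬ LinearIndependent L x := by
  intro hli
  set Ψ : V →ₗ[L] (Fin 2 → L) := LinearMap.pi fun i => B (x i) with hΨ
  have hsurj : Function.Surjective Ψ := fun t => by
    obtain ⟨y, hy⟩ := exists_forall_apply_eq B hc hnd hli t
    exact ⟨y, funext fun i => hy i⟩
  have hrange : finrank L (LinearMap.range Ψ) = 2 := by
    rw [LinearMap.range_eq_top.2 hsurj, finrank_top, Module.finrank_fin_fun]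
  have hrn := LinearMap.finrank_range_add_finrank_ker Ψ
  rw [hrange, hV] at hrn
  -- the pair is an independent family inside `ker Ψ`
  have hmem : ∀ j, x j ∈ LinearMap.ker Ψ := mem_ker_pi_of_null_pair B hx
  have hli' : LinearIndependent L fun j => (⟨x j, hmem j⟩ : LinearMap.ker Ψ) := by
    apply LinearIndependent.of_comp (LinearMap.ker Ψ).subtype
    exact hli
  have h2 := hli'.fintype_card_le_finrank
  rw [Fintype.card_fin] at h2
  omega

/-- **NULL PAIRS ARE `c ⊗ u`**: a non-zero null pair `x` in a non-degenerate hermitian 3-space is `x i = c i • u` for ONE non-zero isotropic vector `u` and a non-zero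
coefficient vector `c ∈ L²`. [cite: KudlaRallis1990, §2] [cite: Rallis1984] -/
theorem exists_eq_smul_of_null_pair [FiniteDimensional L V] (B : V →ₛₗ[c] V →ₗ[L] L) (hc : ∀ x, c (c x) = x)
    (hnd : ∀ x, (∀ y, B x y = 0) → x = 0) (hV : finrank L V = 3)
    {x : Fin 2 → V} (hx : ∀ i j, B (x i) (x j) = 0) (hx0 : x ≠ 0) :
    ∃ u : V, u ≠ 0 ∧ B u u = 0 ∧ ∃ a : Fin 2 → L, a ≠ 0 ∧ ∀ i, x i = a i • u := by
  have hdep := not_linearIndependent_of_null_pair B hc hnd hV hx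
  have hx01 : x = ![x 0, x 1] := by
    funext i
    fin_cases i <;> rfl
  rw [hx01, LinearIndependent.pair_iff] at hdep
  obtain ⟨s, t, hst, hst0⟩ : ∃ s t : L, s • x 0 + t • x 1 = 0 ∧ (s = 0 → t ≠ 0) := by
    by_contra hcon
    refine hdep fun s t hst => ?_
    by_contra hne
    exact hcon ⟨s, t, hst, fun hs ht => hne ⟨hs, ht⟩⟩
  by_cases h0 : x 0 = 0
  · -- `x = (0, x 1)`, `u := x 1`
    have h1 : x 1 ≠ 0 := by
      intro h1
      apply hx0
      funext i
      fin_cases i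
      · exact h0
      · exact h1
    refine ⟨x 1, h1, hx 1 1, ![0, 1], ?_, fun i => ?_⟩
    · intro h
      have := congr_fun h 1
      simp at this
    · fin_cases i
      · simp [h0]
      · simp
  · -- `u := x 0`, `x 1 = −(s∕t) • x 0`
    have ht : t ≠ 0 := by
      intro ht
      rw [ht, zero_smul, add_zero] at hst
      rcases smul_eq_zero.1 hst with hs | hs
      · exact hst0 hs ht
      · exact h0 hs
    have hx1 : x 1 = (-(s / t)) • x 0 := by
      have : t • x 1 = -(s • x 0) := eq_neg_of_add_eq_zero_right hst
      calc x 1 = t⁻¹ • (t • x 1) := by rw [smul_smul, inv_mul_cancel₀ ht, one_smul]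
        _ = (-(s / t)) • x 0 := by rw [this, smul_neg, smul_smul, ← neg_smul, div_eq_inv_mul]
    refine ⟨x 0, h0, hx 0 0, ![1, -(s / t)], ?_, fun i => ?_⟩
    · intro h
      have := congr_fun h 0
      simp at this
    · fin_cases i
      · simp
      · simpa using hx1

/-- the line through an isotropic vector is totally isotropic. [cite: Scharlau1985HermitianForms, Ch. 7 §9] -/
theorem span_singleton_isotropic (B : V →ₛₗ[c] V →ₗ[L] L) {u : V} (hu : B u u = 0) :
    ∀ y ∈ L ∙ u, ∀ z ∈ L ∙ u, B y z = 0 := by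
  intro y hy z hz
  obtain ⟨s, rfl⟩ := Submodule.mem_span_singleton.1 hy
  obtain ⟨t, rfl⟩ := Submodule.mem_span_singleton.1 hz
  rw [LinearMap.map_smulₛₗ₂, LinearMap.map_smul, hu, smul_zero, smul_zero]

end NullPairs

/-! ## §3 (O1) One orbit of `GL₂ × U(V′)` -/

section Orbit

variable {L V : Type*} [Field L] [AddCommGroup V] [Module L V] {c : L →+* L}

/-- **(O1) THE PUNCTURED NULL CONE IS ONE ORBIT OF `GL₂(L) × U(V, B)`.**  For two non-zero null pairs `x, x′` in a non-degenerate hermitian 3-space over a field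
(`c` an involution, `2 ≠ 0`) there are an ISOMETRY `g` of `(V, B)` and an invertible `a ∈ M₂(L)` with `Σ_j a_{ij} • g (x j) = x′ i` for `i = 0, 1`: Witt's theorem
moves the isotropic line of `x` to that of `x′` (★ `exists_isometry_map_eq`), and `GL₂` adjusts the coefficient vector (§1).
[cite: Scharlau1985HermitianForms, Ch. 7 §9 Thm. 9.1] [cite: KudlaRallis1990, §2] [cite: Rallis1984] -/
theorem exists_isometry_matrix_of_null_pairs [FiniteDimensional L V] (B : V →ₛₗ[c] V →ₗ[L] L) (hc : ∀ x, c (c x) = x) (h2 : (2 : L) ≠ 0)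
    (hH : ∀ x y, c (B x y) = B y x) (hnd : ∀ x, (∀ y, B x y = 0) → x = 0) (hV : finrank L V = 3)
    {x x' : Fin 2 → V} (hx : ∀ i j, B (x i) (x j) = 0) (hx0 : x ≠ 0) (hx' : ∀ i j, B (x' i) (x' j) = 0) (hx'0 : x' ≠ 0) :
    ∃ g : V →ₗ[L] V, (∀ y z, B (g y) (g z) = B y z) ∧
      ∃ a : Matrix (Fin 2) (Fin 2) L, IsUnit a.det ∧ ∀ i, ∑ j, a i j • g (x j) = x' i := by
  obtain ⟨u, hu0, hu, p, hp0, hp⟩ := exists_eq_smul_of_null_pair B hc hnd hV hx hx0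
  obtain ⟨u', hu'0, hu', q, hq0, hq⟩ := exists_eq_smul_of_null_pair B hc hnd hV hx' hx'0
  -- Witt on the isotropic lines
  obtain ⟨g, hg, hgU⟩ := exists_isometry_map_eq B hc h2 hH hnd 1 (L ∙ u) (L ∙ u') (span_singleton_isotropic B hu)
    (span_singleton_isotropic B hu') (finrank_span_singleton hu0) (finrank_span_singleton hu'0)
  -- `u′ = μ • g u`, `μ ≠ 0`
  have hu'mem : u' ∈ (L ∙ u).map g := by rw [hgU]; exact Submodule.mem_span_singleton_self u'
  rw [Submodule.map_span, Set.image_singleton] at hu'mem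
  obtain ⟨μ, hμ⟩ := Submodule.mem_span_singleton.1 hu'mem
  have hμ0 : μ ≠ 0 := by
    rintro rfl
    rw [zero_smul] at hμ
    exact hu'0 hμ.symm
  -- `g (x j) = (p j * μ⁻¹) • u′`
  have hgx : ∀ j, g (x j) = (μ⁻¹ * p j) • u' := fun j => by
    rw [hp j, LinearMap.map_smul, ← hμ, smul_smul, mul_comm μ⁻¹, mul_assoc, inv_mul_cancel₀ hμ0, mul_one]
  -- move the coefficient vector `μ⁻¹ p ↦ q`
  have hp0' : (fun j => μ⁻¹ * p j) ≠ 0 := by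
    intro h
    apply hp0
    funext j
    have := congr_fun h j
    simp only [Pi.zero_apply, mul_eq_zero, inv_eq_zero] at this
    exact this.resolve_left hμ0
  obtain ⟨M, hM, hMp⟩ := exists_matrix_two_mulVec_eq _ q hp0' hq0
  refine ⟨g, hg, M, hM, fun i => ?_⟩
  simp_rw [hgx, smul_smul, ← Finset.sum_smul]
  rw [hq i, ← hMp]
  rfl

end Orbit

/-! ## §4 (O1) in coordinates: `V = L³` with Gram matrix `J`, isometries in ★ `unitaryGroupOfForm c J` -/

section Coordinates

/-- **(O1) IN COORDINATES.**  `L` a field with an involution `c` (`2 ≠ 0`), `J ∈ M₃(L)` hermitian (`(J.map c)ᵀ = J`) with `det J ≠ 0` (the local Gram matrix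
`diag(dV′) ⊗ 1` of the auxiliary hermitian 3-space at a non-split place), null pairs `x, x′ : Fin 2 → L³` (`c(x i)ᵀ J (x j) = 0` for all `i, j`), both non-zero:
there are `g ∈ U(J) = unitaryGroupOfForm c J` and an invertible `a ∈ M₂(L)` with `Σ_j a_{ij} • g (x j) = x′ i` — the punctured null cone of `M_{3×2}`-type
pairs is ONE orbit of `GL₂(L) × U(J)` (your `A ↦ g A a⁻¹`).  Packaging of the isometry as a matrix adapted from ★ `K2LiuHermitianWittTransitive`.
[cite: Scharlau1985HermitianForms, Ch. 7 §9 Thm. 9.1] [cite: KudlaRallis1990, §2] -/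
theorem exists_unitary_matrix_of_null_pairs (L : Type) [Field L] (c : L →+* L) (hc : ∀ x, c (c x) = x) (h2 : (2 : L) ≠ 0)
    (J : Matrix (Fin 3) (Fin 3) L) (hJ : (J.map c)ᵀ = J) (hdet : J.det ≠ 0)
    (x x' : Fin 2 → Fin 3 → L)
    (hx : ∀ i j, dotProduct (fun k => c (x i k)) (J.mulVec (x j)) = 0) (hx0 : x ≠ 0)
    (hx' : ∀ i j, dotProduct (fun k => c (x' i k)) (J.mulVec (x' j)) = 0) (hx'0 : x' ≠ 0) :
    ∃ g ∈ Literature.NumberTheory.Automorphic.unitaryGroupOfForm c J, ∃ a : Matrix (Fin 2) (Fin 2) L, IsUnit a.det ∧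
      ∀ i, ∑ j, a i j • (g : Matrix (Fin 3) (Fin 3) L).mulVec (x j) = x' i := by
  classical
  -- the `c`-hermitian form of `J`, bundled (as in ★ `K2LiuHermitianWittTransitive`)
  let B : (Fin 3 → L) →ₛₗ[c] (Fin 3 → L) →ₗ[L] L :=
    LinearMap.mk₂'ₛₗ c (RingHom.id L) (fun u v => dotProduct (fun i => c (u i)) (J.mulVec v))
      (fun u₁ u₂ v => by
        simp only [dotProduct, Pi.add_apply, map_add, add_mul, Finset.sum_add_distrib])
      (fun a u v => by
        simp only [dotProduct, Pi.smul_apply, smul_eq_mul, map_mul, mul_assoc, ← Finset.mul_sum])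
      (fun u v₁ v₂ => by rw [Matrix.mulVec_add, dotProduct_add])
      (fun a u v => by rw [Matrix.mulVec_smul, dotProduct_smul, RingHom.id_apply])
  have hB : ∀ u v, B u v = dotProduct (fun i => c (u i)) (J.mulVec v) := fun u v => rfl
  have hJ' : ∀ i j, c (J i j) = J j i := fun i j => by
    simpa only [Matrix.transpose_apply, Matrix.map_apply] using congr_fun (congr_fun hJ j) i
  have hH : ∀ y z, c (B y z) = B z y := by
    intro y z
    simp only [hB, dotProduct, Matrix.mulVec, map_sum, map_mul, hc, Finset.mul_sum]
    rw [Finset.sum_comm]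
    refine Finset.sum_congr rfl fun i _ => Finset.sum_congr rfl fun j _ => ?_
    rw [hJ' j i]
    ring
  have hnd : ∀ y, (∀ z, B y z = 0) → y = 0 := by
    intro y hy
    have h1 : (fun i => c (y i)) = 0 :=
      (Matrix.nondegenerate_of_det_ne_zero hdet).eq_zero_of_ortho fun w => by rw [← hB]; exact hy w
    funext i
    simpa only [hc, Pi.zero_apply, map_zero] using congrArg c (congr_fun h1 i)
  -- the abstract orbit statement
  obtain ⟨g, hg, a, ha, hga⟩ := exists_isometry_matrix_of_null_pairs B hc h2 hH hnd (Module.finrank_fin_fun L)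
    (fun i j => (hB _ _).trans (hx i j)) hx0 (fun i j => (hB _ _).trans (hx' i j)) hx'0
  -- the matrix of `g` lies in `U(J)`
  set M : Matrix (Fin 3) (Fin 3) L := LinearMap.toMatrix' g with hM
  have hgM : Matrix.toLin' M = g := Matrix.toLin'_toMatrix' g
  have hMul : ∀ y, M.mulVec y = g y := fun y => by rw [← Matrix.toLin'_apply, hgM]
  have hsingle : ∀ i : Fin 3, (fun k => c ((Pi.single i 1 : Fin 3 → L) k)) = Pi.single i 1 := by
    refine fun i => funext fun k => ?_
    rcases eq_or_ne k i with rfl | hk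
    · simp
    · simp [hk]
  have hmem : (M.map c)ᵀ * J * M = J := by
    ext i j
    have h := hg (Pi.single i 1) (Pi.single j 1)
    rw [← hMul, ← hMul, hB, hB, hsingle, single_dotProduct, one_mul] at h
    simp only [Matrix.mulVec_single_one] at h
    change (fun k => (M.map c)ᵀ i k) ⬝ᵥ J *ᵥ M.col j = J i j at h
    rw [Matrix.mul_assoc, Matrix.mul_apply']
    have hcol : (fun l => (J * M) l j) = J.mulVec (M.col j) := by
      funext l
      simp [Matrix.mul_apply, Matrix.mulVec, dotProduct, Matrix.col]
    rw [hcol]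
    exact h
  have hdetM : M.det ≠ 0 := fun h0 => hdet (by
    simpa only [Matrix.det_mul, h0, mul_zero] using (congrArg Matrix.det hmem).symm)
  refine ⟨Matrix.GeneralLinearGroup.mkOfDetNeZero M hdetM, ?_, a, ha, fun i => ?_⟩
  · rw [Literature.NumberTheory.Automorphic.mem_unitaryGroupOfForm_iff, Matrix.GeneralLinearGroup.val_mkOfDetNeZero]
    exact hmem
  · rw [Matrix.GeneralLinearGroup.val_mkOfDetNeZero]
    simp_rw [hMul]
    exact hga i

/-- the `(i, j)` entry of the moment matrix `Q(X) = (X.map c)ᵀ * J * X` is the hermitian pairing of the columns `i`, `j` of `X`. [cite: KudlaRallis1990, §2] -/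
theorem conjTranspose_mul_mul_apply {L : Type*} [Field L] (c : L →+* L) {m n : ℕ} (J : Matrix (Fin m) (Fin m) L) (X : Matrix (Fin m) (Fin n) L) (i j : Fin n) :
    ((X.map c)ᵀ * J * X) i j = dotProduct (fun k => c (X k i)) (J.mulVec fun k => X k j) := by
  simp only [Matrix.mul_apply, Matrix.transpose_apply, Matrix.map_apply, dotProduct, Matrix.mulVec, Finset.sum_mul, Finset.mul_sum, mul_assoc]
  rw [Finset.sum_comm]

/-- **(O1) IN THE MATRIX CURRENCY OF V5** (K2Liu-p09 (g6) 11:27:21Z (q1)): `X : Matrix (Fin 3) (Fin 2) L` (the pair as COLUMNS), moment matrix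
`Q(X) = (X.map c)ᵀ * J * X ∈ Herm₂`, action `X ↦ g * X * a` of `U(J) × GL₂(L)`.  For `Q(X) = 0 = Q(X′)` and `X, X′ ≠ 0` there are `g ∈ unitaryGroupOfForm c J` and an
invertible `a` with `g * X * a = X′` — the punctured null cone `{Q = 0} ∖ 0 ⊆ M_{3×2}(L)` is ONE orbit. [cite: KudlaRallis1990, §2] [cite: Scharlau1985HermitianForms, Ch. 7 §9 Thm. 9.1]
[cite: Rallis1984] -/
theorem exists_unitary_mul_mul_eq_of_null (L : Type) [Field L] (c : L →+* L) (hc : ∀ x, c (c x) = x) (h2 : (2 : L) ≠ 0)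
    (J : Matrix (Fin 3) (Fin 3) L) (hJ : (J.map c)ᵀ = J) (hdet : J.det ≠ 0)
    (X X' : Matrix (Fin 3) (Fin 2) L) (hX : (X.map c)ᵀ * J * X = 0) (hX0 : X ≠ 0) (hX' : (X'.map c)ᵀ * J * X' = 0) (hX'0 : X' ≠ 0) :
    ∃ g ∈ Literature.NumberTheory.Automorphic.unitaryGroupOfForm c J, ∃ a : Matrix (Fin 2) (Fin 2) L, IsUnit a.det ∧
      (g : Matrix (Fin 3) (Fin 3) L) * X * a = X' := by
  -- columns as a pair of vectors
  have hcol0 : ∀ Y : Matrix (Fin 3) (Fin 2) L, Y ≠ 0 → (fun i k => Y k i) ≠ 0 := by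
    intro Y hY h
    apply hY
    ext k i
    exact congr_fun (congr_fun h i) k
  have hnull : ∀ Y : Matrix (Fin 3) (Fin 2) L, (Y.map c)ᵀ * J * Y = 0 →
      ∀ i j, dotProduct (fun k => c ((fun i k => Y k i) i k)) (J.mulVec ((fun i k => Y k i) j)) = 0 := by
    intro Y hY i j
    have h := congr_fun (congr_fun hY i) j
    rw [conjTranspose_mul_mul_apply] at h
    exact h
  obtain ⟨g, hg, a, ha, hga⟩ := exists_unitary_matrix_of_null_pairs L c hc h2 J hJ hdet _ _ (hnull X hX) (hcol0 X hX0) (hnull X' hX') (hcol0 X' hX'0)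
  refine ⟨g, hg, aᵀ, by rw [Matrix.det_transpose]; exact ha, ?_⟩
  ext k i
  have h := congr_fun (hga i) k
  simp only [Finset.sum_apply, Pi.smul_apply, smul_eq_mul, Matrix.mulVec, dotProduct] at h
  rw [Matrix.mul_apply]
  simp only [Matrix.mul_apply, Matrix.transpose_apply, Finset.sum_mul]
  rw [← h]
  refine Finset.sum_congr rfl fun j _ => ?_
  rw [Finset.mul_sum]
  refine Finset.sum_congr rfl fun l _ => ?_
  ring

end Coordinates

end Summit.HodgeConjecture.HodgeConjecture.Cruxes.HLiu418.K2LiuNullConeOrbits
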